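import Mathlib
import HarnessLib

/-!
# ExpOneTranscendenceMeasure

Topic `Literature/NumberTheory/Transcendental`. Named literature fact(s) relocated by the gate from `Summits/Schanuel/Schanuel/Theorems/DiophantineDichotomyEPiSimultaneousTypeEFloor.lean`
(accept-time relocation of `[cite]`d propositions written inline in a Summits proposal; human ruling 2026-08-15).
Sources: NesterenkoWaldschmidt1996.

* `Literature.NumberTheory.Transcendental.NesterenkoWaldschmidt1996_thm_4_2`
-/

namespace Literature.NumberTheory.Transcendental

/-- **Nesterenko–Waldschmidt 1996, Theorem 4 (2)** (transcendence measure of `e`; Yu. Nesterenko,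
M. Waldschmidt, *On the approximation of the values of exponential function and logarithm by algebraic
numbers*, Mat. Zapiski 2 (1996) 23–42 = arXiv:math/0002047, p. 1): "If `P ∈ ℤ[x]`, `P ≠ 0`,
`deg P ≤ d`, `L(P) ≤ L`, and `L ≥ 3`, then `|P(e)| ≥ exp{−1.3·10⁵ d² (log L + d)}`", where
`L(P) = Σᵢ |aᵢ|` is the length of `P` (ibid. p. 1). Stated for `d ≥ 1` (as used in the paper's proof,
`D = d = deg ξ ≥ 1`), with the length written as the sum of `|coeff k|` over `k ≤ deg P` and `P(e)`
read in `ℂ`. NAMED FACT, not proved here; users take `(h : NesterenkoWaldschmidt1996_thm_4_2)`.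
[cite: NesterenkoWaldschmidt1996, Thm 4(2)] [file NumberTheory/Transcendental/ExpOneTranscendenceMeasure] -/
def NesterenkoWaldschmidt1996_thm_4_2 : Prop :=
  ∀ (P : Polynomial ℤ) (d L : ℕ), P ≠ 0 → 1 ≤ d → P.natDegree ≤ d →
    (∑ k ∈ Finset.range (P.natDegree + 1), |P.coeff k|) ≤ (L : ℤ) → 3 ≤ L →
    Real.exp (-(1.3 * 10 ^ 5 * (d : ℝ) ^ 2 * (Real.log L + d))) ≤
      ‖Polynomial.aeval (Real.exp 1 : ℂ) P‖

/-! ## Bookkeeping `MvPolynomial (Fin 1) ℤ ↔ ℤ[X]` -/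

end Literature.NumberTheory.Transcendental
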